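import Summits.ValiantsHypothesis.ValiantsHypothesis.Theorems.BarrierLeverAnchoredDoorHitsLowerPairsKernelLine

/-!
# Support item `AnchoredDoorHitsLowerPairs` (stmt-ValiantsHypothesis-22510), line `anchored-peeling`:
# COFACTOR BASES — explicit spanning families of the left kernel of a tall block with `m` surplus rows (module M2″, general gap)

Helper file (`--supports stmt-ValiantsHypothesis-22510`; cell valiant-natproofs, rung V4, 𝒟-side door (c); registered line
`Cruxes/AnchoredDoorHitsLowerPairs/Lines/anchored_peeling.lean` v13; prover seat val-np-p1 gen 19; blueprint HOME/val-np-p1/g19/QSTEP-BLUEPRINT ADDENDUM 3 (B1)).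
Pure linear algebra over an integral domain. Closes NO item.

A tall matrix is given as a square KEPT block `K : n × n` stacked over DELETED rows `D : δ × n` (`Matrix.fromRows K D`). For each deleted row `d` the row-cofactor
vector of the `(n+1) × n` matrix `[K; D d]` (file `…KernelLine`) is a left-kernel vector `cofactorFamily K D d` supported on the kept rows and on `d`, with entry
`(−1)^n det K` at `d`. If `det K ≠ 0` these `|δ|` vectors SPAN the left kernel up to the scalar `det K`:
`det K • x = Σ_d ((−1)^n x_d) • cofactorFamily K D d` for every `x` with `x ᵥ* [K; D] = 0`. Transported to a square matrix `S` with row predicate `p` and column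
predicate `q` (the tall block being `S[pᶜ, q]`, its kept rows `≃ Fin n`, its deleted rows `≃ δ`) this is exactly the hypothesis `hspan` of
`det_ne_zero_of_blockPairing_basis` (p621324); the column version follows by transposition.

* `extRow`, `cofactorFamily`, `cofactorFamily_vecMul`, `cofactorFamily_inr_self`, `cofactorFamily_inr_ne`, `cofactorFamily_span`.
* `blockKept`, `blockDeleted`, `blockCofactorFamily` (transport to `S, p, q`), `blockCofactorFamily_of_pos`, `blockCofactorFamily_vecMul_of_pos`,
  `blockCofactorFamily_span`.

WHAT THIS IS NOT: no statement about the door; nothing on crux stmt-ValiantsHypothesis-14610 or on `VP` versus `VNP`.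
-/

set_option linter.dupNamespace false

open Matrix

namespace Summit.ValiantsHypothesis.ValiantsHypothesis.Theorems.BarrierLever.AnchoredPeeling

section FinLevel

variable {R : Type*} [CommRing R] {n : ℕ} {δ : Type*} [Fintype δ] [DecidableEq δ]

/-- The kept square block with one deleted row appended (as the last row). -/
def extRow (K : Matrix (Fin n) (Fin n) R) (v : Fin n → R) : Matrix (Fin (n + 1)) (Fin n) R :=
  fun i => Fin.lastCases v (fun i' => K i') i

omit [CommRing R] [Fintype δ] [DecidableEq δ] in
/-- The appended row. -/
theorem extRow_last (K : Matrix (Fin n) (Fin n) R) (v : Fin n → R) : extRow K v (Fin.last n) = v := by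
  simp [extRow]

omit [CommRing R] [Fintype δ] [DecidableEq δ] in
/-- The kept rows. -/
theorem extRow_castSucc (K : Matrix (Fin n) (Fin n) R) (v : Fin n → R) (i' : Fin n) : extRow K v (Fin.castSucc i') = K i' := by
  simp [extRow]

omit [CommRing R] [Fintype δ] [DecidableEq δ] in
/-- Deleting the appended row gives back the kept block. -/
theorem extRow_submatrix_last (K : Matrix (Fin n) (Fin n) R) (v : Fin n → R) :
    (extRow K v).submatrix (Fin.last n).succAbove id = K := by
  ext i j
  rw [Matrix.submatrix_apply, Fin.succAbove_last, extRow_castSucc, id]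

/-- The cofactor family: one left-kernel vector of `[K; D]` per deleted row. -/
def cofactorFamily (K : Matrix (Fin n) (Fin n) R) (D : Matrix δ (Fin n) R) (d : δ) : Fin n ⊕ δ → R
  | Sum.inl i' => Matrix.rowCofactor (extRow K (D d)) (Fin.castSucc i')
  | Sum.inr d' => if d' = d then Matrix.rowCofactor (extRow K (D d)) (Fin.last n) else 0

omit [Fintype δ] in
/-- Entry at its own deleted row: `(−1)^n det K`. -/
theorem cofactorFamily_inr_self (K : Matrix (Fin n) (Fin n) R) (D : Matrix δ (Fin n) R) (d : δ) :
    cofactorFamily K D d (Sum.inr d) = (-1) ^ n * K.det := by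
  simp only [cofactorFamily, if_true]
  rw [rowCofactor_apply, Fin.val_last, extRow_submatrix_last]

omit [Fintype δ] in
/-- Entries at the other deleted rows vanish. -/
theorem cofactorFamily_inr_ne (K : Matrix (Fin n) (Fin n) R) (D : Matrix δ (Fin n) R) {d d' : δ} (h : d' ≠ d) :
    cofactorFamily K D d (Sum.inr d') = 0 := by
  simp only [cofactorFamily, if_neg h]

/-- Each member of the family is a left-kernel vector of the stacked matrix. -/
theorem cofactorFamily_vecMul (K : Matrix (Fin n) (Fin n) R) (D : Matrix δ (Fin n) R) (d : δ) :
    cofactorFamily K D d ᵥ* Matrix.fromRows K D = 0 := by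
  funext j
  have h := congrFun (rowCofactor_vecMul (extRow K (D d))) j
  rw [Pi.zero_apply] at h ⊢
  change ∑ t : Fin (n + 1), Matrix.rowCofactor (extRow K (D d)) t * extRow K (D d) t j = 0 at h
  change ∑ i : Fin n ⊕ δ, cofactorFamily K D d i * Matrix.fromRows K D i j = 0
  rw [Fintype.sum_sum_type]
  simp only [Matrix.fromRows_apply_inl, Matrix.fromRows_apply_inr, cofactorFamily]
  rw [Fin.sum_univ_castSucc] at h
  simp only [extRow_castSucc, extRow_last] at h
  simp only [ite_mul, zero_mul, Finset.sum_ite_eq', Finset.mem_univ, if_true]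
  exact h

/-- **Spanning up to `det K`.** Every left-kernel vector of `[K; D]` satisfies `det K • x = Σ_d ((−1)^n x_d) • cofactorFamily K D d`. -/
theorem cofactorFamily_span [IsDomain R] (K : Matrix (Fin n) (Fin n) R) (D : Matrix δ (Fin n) R) (hK : K.det ≠ 0)
    (x : Fin n ⊕ δ → R) (hx : x ᵥ* Matrix.fromRows K D = 0) :
    K.det • x = ∑ d, ((-1) ^ n * x (Sum.inr d)) • cofactorFamily K D d := by
  classical
  set z : Fin n ⊕ δ → R := K.det • x - ∑ d, ((-1) ^ n * x (Sum.inr d)) • cofactorFamily K D d with hz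
  suffices hz0 : z = 0 by exact sub_eq_zero.mp hz0
  have hn : ((-1 : R) ^ n) ^ 2 = 1 := by rw [← pow_mul, mul_comm, pow_mul, neg_one_sq, one_pow]
  have hzinr : ∀ d', z (Sum.inr d') = 0 := by
    intro d'
    simp only [hz, Pi.sub_apply, Pi.smul_apply, Finset.sum_apply, smul_eq_mul]
    rw [Finset.sum_eq_single d' (fun d _ hd => by rw [cofactorFamily_inr_ne K D (Ne.symm hd), mul_zero])
      (fun h' => (h' (Finset.mem_univ _)).elim), cofactorFamily_inr_self]
    linear_combination (-(K.det * x (Sum.inr d'))) * hn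
  have hlin : ∀ v : Fin n ⊕ δ → R, v ᵥ* Matrix.fromRows K D = (Matrix.fromRows K D).vecMulLinear v := fun v => rfl
  have hzM : z ᵥ* Matrix.fromRows K D = 0 := by
    rw [hz, hlin, map_sub, map_smul, map_sum, ← hlin, hx, smul_zero, zero_sub, neg_eq_zero]
    refine Finset.sum_eq_zero (fun d _ => ?_)
    rw [map_smul, ← hlin, cofactorFamily_vecMul, smul_zero]
  have hzK : (fun i' => z (Sum.inl i')) ᵥ* K = 0 := by
    funext j
    have hj := congrFun hzM j
    rw [Pi.zero_apply] at hj ⊢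
    change ∑ i, z i * Matrix.fromRows K D i j = 0 at hj
    rw [Fintype.sum_sum_type] at hj
    simp only [Matrix.fromRows_apply_inl, Matrix.fromRows_apply_inr, hzinr, zero_mul, Finset.sum_const_zero, add_zero] at hj
    exact hj
  have hzinl := Matrix.eq_zero_of_vecMul_eq_zero hK hzK
  funext i
  cases i with
  | inl i' => exact congrFun hzinl i'
  | inr d' => exact hzinr d'

end FinLevel

section Transport

variable {A : Type*} [CommRing A] [IsDomain A] {m : Type*} [Fintype m] [DecidableEq m]
  (S : Matrix m m A) (p q : m → Prop) [DecidablePred p] [DecidablePred q] {n : ℕ} {δ : Type*} [Fintype δ] [DecidableEq δ]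
  (e : {i : m // ¬ p i} ≃ Fin n ⊕ δ) (eQ : {j : m // q j} ≃ Fin n)

/-- The kept square block of `S[pᶜ, q]`. -/
def blockKept : Matrix (Fin n) (Fin n) A := fun x y => S (e.symm (Sum.inl x)).1 (eQ.symm y).1

/-- The deleted rows of `S[pᶜ, q]`. -/
def blockDeleted : Matrix δ (Fin n) A := fun d y => S (e.symm (Sum.inr d)).1 (eQ.symm y).1

/-- The cofactor family transported to `m` and extended by zero on the `p`-rows. -/
def blockCofactorFamily (d : δ) : m → A := fun i =>
  if hi : p i then 0 else cofactorFamily (blockKept S p q e eQ) (blockDeleted S p q e eQ) d (e ⟨i, hi⟩)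

omit [IsDomain A] [Fintype m] [DecidableEq m] [DecidablePred q] [Fintype δ] in
/-- Vanishing on the `p`-rows. -/
theorem blockCofactorFamily_of_pos (d : δ) {i : m} (hi : p i) : blockCofactorFamily S p q e eQ d i = 0 := by
  simp [blockCofactorFamily, hi]

omit [IsDomain A] [Fintype m] [DecidableEq m] [DecidablePred q] [Fintype δ] in
/-- Off the `p`-rows: the Fin-level family. -/
theorem blockCofactorFamily_of_neg (d : δ) {i : m} (hi : ¬ p i) :
    blockCofactorFamily S p q e eQ d i = cofactorFamily (blockKept S p q e eQ) (blockDeleted S p q e eQ) d (e ⟨i, hi⟩) := by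
  simp [blockCofactorFamily, hi]

omit [CommRing A] [IsDomain A] [Fintype m] [DecidableEq m] [DecidablePred p] [DecidablePred q] [Fintype δ] [DecidableEq δ] in
/-- The stacked Fin-level matrix is the reindexed tall block. -/
private theorem fromRows_block_apply (t : Fin n ⊕ δ) (y : Fin n) :
    Matrix.fromRows (blockKept S p q e eQ) (blockDeleted S p q e eQ) t y = S (e.symm t).1 (eQ.symm y).1 := by
  cases t with
  | inl x => rfl
  | inr d => rfl

omit [IsDomain A] [DecidableEq m] [DecidablePred q] in
/-- Each transported member kills the `q`-columns of `S`. -/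
theorem blockCofactorFamily_vecMul_of_pos (d : δ) {j : m} (hj : q j) : (blockCofactorFamily S p q e eQ d ᵥ* S) j = 0 := by
  have h := congrFun (cofactorFamily_vecMul (blockKept S p q e eQ) (blockDeleted S p q e eQ) d) (eQ ⟨j, hj⟩)
  rw [Pi.zero_apply] at h
  change ∑ t, cofactorFamily (blockKept S p q e eQ) (blockDeleted S p q e eQ) d t *
      Matrix.fromRows (blockKept S p q e eQ) (blockDeleted S p q e eQ) t (eQ ⟨j, hj⟩) = 0 at h
  simp only [fromRows_block_apply, Equiv.symm_apply_apply] at h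
  change ∑ i, blockCofactorFamily S p q e eQ d i * S i j = 0
  rw [← Fintype.sum_subtype_add_sum_subtype p, Fintype.sum_eq_zero (fun i : {i : m // p i} => blockCofactorFamily S p q e eQ d i.1 * S i.1 j)
    (fun i => by rw [blockCofactorFamily_of_pos S p q e eQ d i.2, zero_mul]), zero_add,
    ← e.symm.sum_comp (fun i : {i : m // ¬ p i} => blockCofactorFamily S p q e eQ d i.1 * S i.1 j), ← h]
  refine Finset.sum_congr rfl (fun t _ => ?_)
  rw [blockCofactorFamily_of_neg S p q e eQ d (e.symm t).2]
  simp

omit [DecidableEq m] [DecidablePred q] in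
/-- **Spanning, transported.** If the kept block is nonsingular, every `x` supported off `p` that kills the `q`-columns of `S` is, up to the scalar `det K ≠ 0`,
a combination of the transported cofactor family — the hypothesis `hspan` of `det_ne_zero_of_blockPairing_basis`. -/
theorem blockCofactorFamily_span (hK : (blockKept S p q e eQ).det ≠ 0) (x : m → A) (hxp : ∀ i, p i → x i = 0)
    (hxq : ∀ j, q j → (x ᵥ* S) j = 0) :
    ∃ μ : A, μ ≠ 0 ∧ ∃ c : δ → A, μ • x = ∑ d, c d • blockCofactorFamily S p q e eQ d := by
  classical
  let x' : Fin n ⊕ δ → A := fun t => x (e.symm t).1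
  have hx' : x' ᵥ* Matrix.fromRows (blockKept S p q e eQ) (blockDeleted S p q e eQ) = 0 := by
    funext y
    rw [Pi.zero_apply]
    have hy := hxq (eQ.symm y).1 (eQ.symm y).2
    change ∑ i, x i * S i (eQ.symm y).1 = 0 at hy
    rw [← Fintype.sum_subtype_add_sum_subtype p, Fintype.sum_eq_zero (fun i : {i : m // p i} => x i.1 * S i.1 (eQ.symm y).1)
      (fun i => by rw [hxp i.1 i.2, zero_mul]), zero_add, ← e.symm.sum_comp] at hy
    change ∑ t, x' t * Matrix.fromRows (blockKept S p q e eQ) (blockDeleted S p q e eQ) t y = 0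
    simp only [fromRows_block_apply]
    exact hy
  have hspan := cofactorFamily_span (blockKept S p q e eQ) (blockDeleted S p q e eQ) hK x' hx'
  refine ⟨(blockKept S p q e eQ).det, hK, fun d => (-1) ^ n * x' (Sum.inr d), ?_⟩
  funext i
  by_cases hi : p i
  · simp only [Pi.smul_apply, Finset.sum_apply, smul_eq_mul, hxp i hi, mul_zero, blockCofactorFamily_of_pos S p q e eQ _ hi,
      Finset.sum_const_zero]
  · have := congrFun hspan (e ⟨i, hi⟩)
    simp only [Pi.smul_apply, Finset.sum_apply, smul_eq_mul, x', Equiv.symm_apply_apply] at this ⊢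
    rw [this]
    refine Finset.sum_congr rfl (fun d _ => ?_)
    rw [blockCofactorFamily_of_neg S p q e eQ d hi]

end Transport

end Summit.ValiantsHypothesis.ValiantsHypothesis.Theorems.BarrierLever.AnchoredPeeling
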